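import Literature.Topology.FourManifolds.CollarReparamCalculus
import Literature.Topology.FourManifolds.OpenCollar
import Literature.Geometry.Lorentzian.Isometry
import HarnessLib

/-!
# Reparametrising a closed collar by `tanh`: the long open collar and the pullback formula

Support file (everything proved, no definitions, no named facts) for the τ-equivariant collar
gluing of two umbilic collared metrics (stub `stub_collarGluing` of crux `CorkRegluablePsc`,
item stmt-SmoothPoincare4-3206), continuing `CollarReparamCalculus.lean`.

* `BoundaryData.Collar.exists_openCollar_tanh` — a closed collar `c : ∂M × [0, 1] ↪ M`
  (`Literature.Topology.FourManifolds.BoundaryData.Collar`, Hirsch 1976, §4.6) yields a LONG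
  open collar (`Literature.Topology.FourManifolds.BoundaryData.OpenCollar`, Bröcker–Jänich
  1982, (13.6): "if we so wish, we can map `∂M × ℝ₊`") by the reparametrisation
  `(x, t) ↦ c (x, tanh t)`, `t ∈ [0, ∞)`, with inverse `z ↦ (pr₁ (c⁻¹ z), artanh (pr₂ (c⁻¹ z)))`
  on the open region `c (∂M × [0, 1))` (the inverse of a smooth embedding is smooth on its
  range, `Literature.Geometry.Manifold.contMDiffOn_invFun_range`).  This is the collar input of
  the three-piece gluing `M ∪_φ N` of `BoundaryGluingConstruction.lean`.
* `pullbackBilin_collar_reparam` — **the pullback formula along a reparametrised collar**: if a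
  field of bilinear forms `G` on `TM` pulls back under the closed collar to the warped form
  `(c^* G)_{(x, s)}(V, V') = ε² V₂ V'₂ + F(x, s) h_x(V₁, V'₁)` (Bär–Hanke 2023, §3, Def. 21:
  `C`-normal metrics `dt² + …`), then along `q ↦ c (ψ q₁, ρ q₂)` (`ψ` differentiable,
  `ρ q₂ ∈ (0, 1)`, `ρ` differentiable at `q₂`) it pulls back to
  `ε² ρ'(q₂)² v₂ w₂ + F(ψ q₁, ρ q₂) h_{ψ q₁}(dψ v₁, dψ w₁)` (chain rule, O'Neill 1983, Ch. 3,
  p. 58, with the derivative into `[0, 1]` of `CollarReparamCalculus.lean`).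

## References

* T. Bröcker, K. Jänich, *Introduction to Differential Topology* (1982), (13.5)–(13.6). [BrockerJanich1982]
* M. W. Hirsch, *Differential Topology* (1976), §4.6, Ch. 8 §2. [Hirsch1976]
* B. O'Neill, *Semi-Riemannian Geometry* (1983), Ch. 3, Def. 3.9, p. 58. [ONeill1983]
* C. Bär, B. Hanke, *Boundary conditions for scalar curvature* (2023), §3, Def. 21. [BarHanke2023]
-/

noncomputable section

open scoped Manifold ContDiff Topology
open Set Function Filter

namespace Literature.Topology.FourManifolds

universe u

/-! ### The long open collar of a closed collar -/

section OpenCollar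

variable {n : ℕ} {M : Type u} [TopologicalSpace M] [ChartedSpace (EuclideanHalfSpace (n + 1)) M]
  {b : BoundaryData (𝓡∂ (n + 1)) M (𝓡 n)}

/-- **A closed collar yields a long open collar** by `(x, t) ↦ c (x, tanh t)` on `∂M × [0, ∞)`,
with region `c (∂M × [0, 1))` and inverse `(pr₁ ∘ c⁻¹, artanh ∘ pr₂ ∘ c⁻¹)` (Bröcker–Jänich
1982, (13.6); smoothness of `c⁻¹` on `range c`: Lee 2013, Prop. 4.22).
[cite: BrockerJanich1982, (13.6)] -/
theorem BoundaryData.Collar.exists_openCollar_tanh [Nonempty b.carrier] (c : b.Collar) :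
    ∃ D : b.OpenCollar,
      (∀ x t, D.toFun x t = c (x, Set.projIcc (0 : ℝ) 1 zero_le_one (Real.tanh t))) ∧
      D.region = c '' {p | (p.2 : ℝ) < 1} := by
  classical
  have hinj : Injective c := c.injective
  have hli : LeftInverse (invFun c) c := leftInverse_invFun hinj
  have hinv : ContMDiffOn (𝓡∂ (n + 1)) ((𝓡 n).prod (𝓡∂ 1)) ∞ (invFun c) (range c) :=
    Literature.Geometry.Manifold.contMDiffOn_invFun_range c.isSmoothEmbedding
  have hsub : c '' {p : b.carrier × Set.Icc (0 : ℝ) 1 | (p.2 : ℝ) < 1} ⊆ range c :=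
    image_subset_range _ _
  -- the value of `projIcc (tanh t)` for `t ≥ 0`
  have hproj : ∀ {t : ℝ}, 0 ≤ t →
      (Set.projIcc (0 : ℝ) 1 zero_le_one (Real.tanh t) : ℝ) = Real.tanh t := fun {t} ht ↦ by
    rw [Set.projIcc_of_mem zero_le_one (tanh_mem_Icc ht)]
  refine ⟨{ toFun := fun x t ↦ c (x, Set.projIcc (0 : ℝ) 1 zero_le_one (Real.tanh t))
            proj := fun z ↦ (invFun c z).1
            height := fun z ↦ Real.artanh ((invFun c z).2 : ℝ)
            region := c '' {p | (p.2 : ℝ) < 1}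
            isOpen_region := c.isOpen_image
            apply_zero := fun x ↦ ?_
            mem_region := fun x t ht ↦ ?_
            proj_apply := fun x t ht ↦ ?_
            height_apply := fun x t ht ↦ ?_
            height_nonneg := ?_
            apply_proj_height := ?_
            contMDiffOn_toFun := ?_
            contMDiffOn_proj := ?_
            contMDiffOn_height := ?_ }, fun x t ↦ rfl, rfl⟩
  · -- `apply_zero`
    have h0 : Set.projIcc (0 : ℝ) 1 zero_le_one (Real.tanh 0) = ⊥ :=
      Subtype.ext (by rw [Real.tanh_zero, Set.projIcc_left, Set.Icc.coe_bot])
    show c (x, Set.projIcc (0 : ℝ) 1 zero_le_one (Real.tanh 0)) = b.incl x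
    rw [h0, c.apply_bot]
  · -- `mem_region`
    refine ⟨(x, Set.projIcc (0 : ℝ) 1 zero_le_one (Real.tanh t)), ?_, rfl⟩
    show (Set.projIcc (0 : ℝ) 1 zero_le_one (Real.tanh t) : ℝ) < 1
    rw [hproj ht]
    exact Real.tanh_lt_one t
  · -- `proj_apply`
    show (invFun c (c (x, _))).1 = x
    rw [hli]
  · -- `height_apply`
    show Real.artanh ((invFun c (c (x, _))).2 : ℝ) = t
    rw [hli, hproj ht, Real.artanh_tanh]
  · -- `height_nonneg`
    rintro _ ⟨p, -, rfl⟩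
    show 0 ≤ Real.artanh ((invFun c (c p)).2 : ℝ)
    rw [hli]
    exact Real.artanh_nonneg p.2.2.1
  · -- `apply_proj_height`
    rintro _ ⟨p, hp, rfl⟩
    have hp' : (p.2 : ℝ) ∈ Ioo (-1 : ℝ) 1 := ⟨by linarith [p.2.2.1], hp⟩
    show c ((invFun c (c p)).1,
      Set.projIcc (0 : ℝ) 1 zero_le_one (Real.tanh (Real.artanh ((invFun c (c p)).2 : ℝ)))) = c p
    rw [hli, Real.tanh_artanh hp', Set.projIcc_val zero_le_one p.2]
  · -- `contMDiffOn_toFun`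
    have hin : ContMDiffOn ((𝓡 n).prod 𝓘(ℝ, ℝ)) ((𝓡 n).prod (𝓡∂ 1)) ∞
        (fun p : b.carrier × ℝ ↦ (p.1, Set.projIcc (0 : ℝ) 1 zero_le_one (Real.tanh p.2)))
        (univ ×ˢ Ici (0 : ℝ)) := by
      refine contMDiffOn_fst.prodMk ?_
      have ht : ContMDiff ((𝓡 n).prod 𝓘(ℝ, ℝ)) 𝓘(ℝ, ℝ) ∞ fun p : b.carrier × ℝ ↦ Real.tanh p.2 :=
        contDiff_real_tanh.contMDiff.comp contMDiff_snd
      exact contMDiffOn_projIcc.comp ht.contMDiffOn fun p hp ↦ tanh_mem_Icc hp.2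
    exact (c.isSmoothEmbedding.contMDiff.comp_contMDiffOn hin).congr fun p _ ↦ rfl
  · -- `contMDiffOn_proj`
    exact contMDiff_fst.comp_contMDiffOn (hinv.mono hsub)
  · -- `contMDiffOn_height`
    have h2 : ContMDiffOn (𝓡∂ (n + 1)) 𝓘(ℝ, ℝ) ∞ (fun z ↦ ((invFun c z).2 : ℝ))
        (c '' {p | (p.2 : ℝ) < 1}) :=
      (contMDiff_subtype_coe_Icc.comp contMDiff_snd).comp_contMDiffOn (hinv.mono hsub)
    refine (contDiffOn_real_artanh.contMDiffOn.comp h2 ?_).congr fun z _ ↦ rfl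
    rintro _ ⟨p, hp, rfl⟩
    show ((invFun c (c p)).2 : ℝ) ∈ Ioo (-1 : ℝ) 1
    rw [hli]
    exact ⟨by linarith [p.2.2.1], hp⟩

end OpenCollar

/-! ### The pullback formula along a reparametrised collar -/

section Pullback

open Literature.Geometry.Lorentzian

variable {n : ℕ} {M : Type u} [TopologicalSpace M] [ChartedSpace (EuclideanHalfSpace (n + 1)) M]
  {b : BoundaryData (𝓡∂ (n + 1)) M (𝓡 n)}
  {E' : Type*} [NormedAddCommGroup E'] [NormedSpace ℝ E'] {H' : Type*} [TopologicalSpace H']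
  {I' : ModelWithCorners ℝ E' H'} {N : Type*} [TopologicalSpace N] [ChartedSpace H' N]

/-- **The pullback of a warped collar form along a reparametrisation `q ↦ c (ψ q₁, ρ q₂)`.**
Let `c : ∂M × [0, 1] ↪ M` be a closed collar and `G` a field of bilinear forms on `TM` with
`(c^* G)_{(x, s)}(V, V') = ε² V₂ V'₂ + F(x, s) h_x(V₁, V'₁)` (`V₂`, `V'₂` the coordinates of the
`[0, 1]`-components).  If `ψ : N → ∂M` is differentiable at `q₁` and `ρ : ℝ → ℝ` has derivative
`ρ'` at `q₂` with `ρ q₂ ∈ (0, 1)`, then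
`((c ∘ (ψ × ρ))^* G)_q (v, w) = ε² ρ'² v₂ w₂ + F(ψ q₁, ρ q₂) h_{ψ q₁}(dψ v₁, dψ w₁)`
(chain rule; the derivative of `ρ` into `[0, 1]` is `c ↦ c ρ' e₀` in the left chart).
[cite: ONeill1983, Ch. 3, Def. 3.9 and p. 58] -/
theorem pullbackBilin_collar_reparam (c : b.Collar)
    (G : Π x : M, TangentSpace (𝓡∂ (n + 1)) x →L[ℝ] TangentSpace (𝓡∂ (n + 1)) x →L[ℝ] ℝ)
    (h : Π x : b.carrier, TangentSpace (𝓡 n) x →L[ℝ] TangentSpace (𝓡 n) x →L[ℝ] ℝ)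
    (F : b.carrier × Set.Icc (0 : ℝ) 1 → ℝ) (ε : ℝ)
    (hc : ∀ (p : b.carrier × Set.Icc (0 : ℝ) 1) (V V' : TangentSpace ((𝓡 n).prod (𝓡∂ 1)) p),
      pullbackBilin (I := 𝓡∂ (n + 1)) (I' := (𝓡 n).prod (𝓡∂ 1)) c G p V V' =
        ε ^ 2 * ((show EuclideanSpace ℝ (Fin 1) from V.2) 0 *
          (show EuclideanSpace ℝ (Fin 1) from V'.2) 0) + F p * h p.1 V.1 V'.1)
    {ψ : N → b.carrier} {ρ : ℝ → ℝ} {ρ' : ℝ} {q : N × ℝ}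
    (hψ : MDifferentiableAt I' (𝓡 n) ψ q.1) (hρ : HasDerivAt ρ ρ' q.2) (hρq : ρ q.2 ∈ Ioo (0 : ℝ) 1)
    (v w : TangentSpace (I'.prod 𝓘(ℝ, ℝ)) q) :
    pullbackBilin (I := 𝓡∂ (n + 1)) (I' := I'.prod 𝓘(ℝ, ℝ))
        (fun q : N × ℝ ↦ c (ψ q.1, Set.projIcc (0 : ℝ) 1 zero_le_one (ρ q.2))) G q v w =
      ε ^ 2 * ρ' ^ 2 * (v.2 * w.2) +
        F (ψ q.1, Set.projIcc (0 : ℝ) 1 zero_le_one (ρ q.2)) *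
          h (ψ q.1) (mfderiv I' (𝓡 n) ψ q.1 v.1) (mfderiv I' (𝓡 n) ψ q.1 w.1) := by
  -- the inner map `Φ q = (ψ q₁, projIcc (ρ q₂))` and its derivative
  set Φ : N × ℝ → b.carrier × Set.Icc (0 : ℝ) 1 :=
    fun q ↦ (ψ q.1, Set.projIcc (0 : ℝ) 1 zero_le_one (ρ q.2)) with hΦ
  set L : ℝ →L[ℝ] EuclideanSpace ℝ (Fin 1) :=
    (1 : ℝ →L[ℝ] ℝ).smulRight (EuclideanSpace.single (0 : Fin 1) ρ') with hL
  have h1 : HasMFDerivAt (I'.prod 𝓘(ℝ, ℝ)) (𝓡 n) (fun q : N × ℝ ↦ ψ q.1) q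
      ((mfderiv I' (𝓡 n) ψ q.1).comp
        (ContinuousLinearMap.fst ℝ (TangentSpace I' q.1) (TangentSpace 𝓘(ℝ, ℝ) q.2))) :=
    hψ.hasMFDerivAt.comp q (hasMFDerivAt_fst q)
  have h2 : HasMFDerivAt (I'.prod 𝓘(ℝ, ℝ)) (𝓡∂ 1)
      (fun q : N × ℝ ↦ Set.projIcc (0 : ℝ) 1 zero_le_one (ρ q.2)) q
      (L.comp (ContinuousLinearMap.snd ℝ (TangentSpace I' q.1) (TangentSpace 𝓘(ℝ, ℝ) q.2))) :=
    (hasMFDerivAt_projIcc_comp hρ hρq).comp q (hasMFDerivAt_snd q)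
  have hΦd : HasMFDerivAt (I'.prod 𝓘(ℝ, ℝ)) ((𝓡 n).prod (𝓡∂ 1)) Φ q
      (((mfderiv I' (𝓡 n) ψ q.1).comp
        (ContinuousLinearMap.fst ℝ (TangentSpace I' q.1) (TangentSpace 𝓘(ℝ, ℝ) q.2))).prod
        (L.comp (ContinuousLinearMap.snd ℝ (TangentSpace I' q.1) (TangentSpace 𝓘(ℝ, ℝ) q.2)))) :=
    h1.prodMk h2
  have hcd : MDifferentiableAt ((𝓡 n).prod (𝓡∂ 1)) (𝓡∂ (n + 1)) c (Φ q) :=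
    (c.isSmoothEmbedding.contMDiff (Φ q)).mdifferentiableAt (by simp)
  -- chain rule
  have hcomp : mfderiv (I'.prod 𝓘(ℝ, ℝ)) (𝓡∂ (n + 1)) (c ∘ Φ) q =
      (mfderiv ((𝓡 n).prod (𝓡∂ 1)) (𝓡∂ (n + 1)) c (Φ q)).comp
        (mfderiv (I'.prod 𝓘(ℝ, ℝ)) ((𝓡 n).prod (𝓡∂ 1)) Φ q) :=
    mfderiv_comp q hcd hΦd.mdifferentiableAt
  have hfun : (fun q : N × ℝ ↦ c (ψ q.1, Set.projIcc (0 : ℝ) 1 zero_le_one (ρ q.2))) = c ∘ Φ :=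
    rfl
  have hD := hΦd.mfderiv
  -- the derivative `D` of `Φ` and its components
  set D := ((mfderiv I' (𝓡 n) ψ q.1).comp
    (ContinuousLinearMap.fst ℝ (TangentSpace I' q.1) (TangentSpace 𝓘(ℝ, ℝ) q.2))).prod
    (L.comp (ContinuousLinearMap.snd ℝ (TangentSpace I' q.1) (TangentSpace 𝓘(ℝ, ℝ) q.2))) with hDdef
  have hsnd : ∀ u : TangentSpace (I'.prod 𝓘(ℝ, ℝ)) q,
      (show EuclideanSpace ℝ (Fin 1) from (D u).2) 0 = u.2 * ρ' := fun u ↦ by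
    show (L u.2) 0 = u.2 * ρ'
    exact smulRight_single_apply ρ' u.2 0
  have hfst : ∀ u : TangentSpace (I'.prod 𝓘(ℝ, ℝ)) q, (D u).1 = mfderiv I' (𝓡 n) ψ q.1 u.1 :=
    fun u ↦ rfl
  have hv : ∀ u : TangentSpace (I'.prod 𝓘(ℝ, ℝ)) q,
      mfderiv (I'.prod 𝓘(ℝ, ℝ)) (𝓡∂ (n + 1)) (c ∘ Φ) q u =
        mfderiv ((𝓡 n).prod (𝓡∂ 1)) (𝓡∂ (n + 1)) c (Φ q) (D u) := fun u ↦ by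
    rw [hcomp, hD]
    rfl
  rw [hfun, pullbackBilin_apply, hv v, hv w]
  have key := hc (Φ q) (D v) (D w)
  rw [pullbackBilin_apply, hsnd v, hsnd w, hfst v, hfst w] at key
  refine key.trans ?_
  ring

end Pullback

end Literature.Topology.FourManifolds
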